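import Mathlib
import Summits.Ventures.HSemireg.LineLawGeneralCapture
import Summits.Ventures.HSemireg.LineLawCommonRoot
import Literature.NumberTheory.CubicFields.ReducibleMaximality

/-!
# LINE LAW — the GENERAL CAPTURE for EVERY squarefree `m < 0` under one class per genus, and THEOREM A «⇐» assembled for
# `m ≡ 2, 3 (mod 4)` with even and ramified weights (ENGINE-W code B, #B26)

#B22 `LineLawGeneralCapture` proved, for `m ≡ 1 (mod 4)`, that a primitive norm `n = x² − m y² > 0` with a root `A` (`A² − n k = m`)
and `(n, 2A, k)` primitive is CAPTURED at `A` under one class per genus for `4m` — the assigned characters being the `χ_q` only.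
For `m ≡ 3 (mod 4)` the discriminant `4m` also carries `δ = χ₄`, for `m ≡ 2 (mod 8)` `ε = χ₈`, for `m ≡ 6 (mod 8)` `δε = χ₈'`
(Cox's table; tree `AssignedCharacters`).  This file evaluates those 2-adic characters at a value `v` of `(n, 2A, k)` prime to `4m`
— `v ≡ 1 (mod 4)`, `v ≡ ±1 (mod 8)`, `v ≡ 1, 3 (mod 8)` respectively — by a FINITE computation on squares modulo `8` ∕ `16`
(`delta_table`, `eps_table`, kernel `decide` over `648` ∕ `8 192` residue tuples; glue `mod_four_of_delta`, `mod_eight_of_eps`),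
and concludes:
* `capture_all_of_forall_genus` ∕ `capture_all` ∕ `capture_all_of_parity` — for ANY squarefree `m < 0` with `h(4m) = 2^{μ−1}`:
  `n = x² − m y² > 0` (`x, y` coprime), `A² − n k = m`, `(n, 2A, k)` primitive (⟺ `n` or `k` odd) ⇒ a primitive `z ∈ ℤ√m` with
  `N z = n` divides `A − √m`.  No residue, parity or coprimality hypothesis on `m` or `n`: supersedes 315 `capture` (`n ⊥ 4m`),
  331 `capture_ramified` (root agreement) and #B22 (`m ≡ 1 (4)`) at once.
* `lineLaw_sufficiency_two_three` — THEOREM A «⇐» ASSEMBLED for `m ≡ 2, 3 (mod 4)` (LINE-LAW-THEOREMS-B §2): every listed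
  quotient a primitive norm ⇒ ONE `A` at which all are captured — the 2-ADIC RULE is AUTOMATIC here (`e = 1`: an even primitive
  norm is `≡ 2 (mod 4)` and so is `A² − m`, `not_four_dvd_sq_sub`), so 324's common root needs no adjustment.  (For
  `m ≡ 1 (mod 4)` the assembled statement is #B23 `lineLaw_sufficiency_one_mod_four`.)
So THEOREM A ∕ A′ «⇐» is kernel for every imaginary one-class-per-genus order `ℤ[√m]`, `m` squarefree, modulo THEOREM CF⁶ by value.
Honest framing: form ∕ ideal arithmetic of `ℤ√m` only; Mukai vectors and lattices elsewhere, not objects; nothing here says that HC,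
HC_CM or HC_AV holds.
-/

open scoped nonZeroDivisors

namespace Summit.Ventures.HSemireg.LineLawGeneralCaptureAll

open Zsqrtd
open Literature.NumberTheory.QuadraticFields (BinaryQuadraticForm.classNumber)
open Literature.NumberTheory.QuadraticFields.BinaryQuadraticForm (assignedCharCount)
open Literature.NumberTheory.QuadraticFields.Quadratic
open Literature.NumberTheory.QuadraticFields.Quadratic.GaussChar
open Literature.Computability.Cryptography.Hallgren2005.OrderCl (NegDiscr)
open Literature.Computability.Cryptography.Hallgren2005.FormComposition (one isPosPrim_one)
open Summit.Ventures.HSemireg.LineLawPrincipalGenus (dvd_and_norm_of_span_eq isCoprime_of_dvd ideal_lineForm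
  one_four_mul_eq_principalForm exists_span_singleton_of_coe_isPrincipal exists_root_of_primitive_rep)
open Summit.Ventures.HSemireg.LineLawGeneralCapture (lineForm_isPosPrim_of_primitive lineForm_primitive_of_squarefree
  legendreSym_value_eq_one eval_mul_n)
open Summit.Ventures.HSemireg.LineLawCommonRoot (exists_common_root)

/-! ## Finite tables (squares modulo `8` and `16`) -/

/-- Squares modulo `8` are `0, 1, 4`. -/
theorem sq_mod_eight (X : ZMod 8) : ∃ i : Fin 3, X ^ 2 = (![0, 1, 4] : Fin 3 → ZMod 8) i := by
  revert X; decide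

/-- Squares modulo `16` are `0, 1, 4, 9`. -/
theorem sq_mod_sixteen (X : ZMod 16) : ∃ i : Fin 4, X ^ 2 = (![0, 1, 4, 9] : Fin 4 → ZMod 16) i := by
  revert X; decide

/-- Odd residues modulo `8`. -/
theorem odd_mod_eight (T : ZMod 8) : ∃ i : Fin 4, 2 * T + 1 = (![1, 3, 5, 7] : Fin 4 → ZMod 8) i := by
  revert T; decide

/-- Odd residues modulo `16`. -/
theorem odd_mod_sixteen (T : ZMod 16) :
    ∃ i : Fin 8, 2 * T + 1 = (![1, 3, 5, 7, 9, 11, 13, 15] : Fin 8 → ZMod 16) i := by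
  revert T; decide

/-- An odd square is `1 (mod 8)`. -/
theorem odd_sq_mod_eight (T : ZMod 8) : (2 * T + 1) ^ 2 = 1 := by
  revert T; decide

/-- An odd square is `1` or `9 (mod 16)`. -/
theorem odd_sq_mod_sixteen (T : ZMod 16) : (2 * T + 1) ^ 2 = 1 ∨ (2 * T + 1) ^ 2 = 9 := by
  revert T; decide

/-- **The `δ` table** (`m ≡ 3 (mod 4)`, residues mod `8`): `v·(x² − m y²) ≡ a² − m b²`, `v` odd, `x` or `y` odd ⇒ `v ≡ 1 (mod 4)`.
(`648` cases, kernel `decide`.) -/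
theorem delta_table : ∀ (i : Fin 4) (j : Fin 2) (a b c d : Fin 3),
    ((![0, 1, 4] : Fin 3 → ZMod 8) c = 1 ∨ (![0, 1, 4] : Fin 3 → ZMod 8) d = 1) →
    (![1, 3, 5, 7] : Fin 4 → ZMod 8) i *
        ((![0, 1, 4] : Fin 3 → ZMod 8) c - (![3, 7] : Fin 2 → ZMod 8) j * (![0, 1, 4] : Fin 3 → ZMod 8) d)
      = (![0, 1, 4] : Fin 3 → ZMod 8) a - (![3, 7] : Fin 2 → ZMod 8) j * (![0, 1, 4] : Fin 3 → ZMod 8) b →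
    (![1, 3, 5, 7] : Fin 4 → ZMod 8) i = 1 ∨ (![1, 3, 5, 7] : Fin 4 → ZMod 8) i = 5 := by
  decide

/-- **The `ε ∕ δε` table** (`m ≡ 2 (mod 4)`, residues mod `16`): `v·(x² − m y²) ≡ a² − m b²`, `v` odd, `x` or `y` odd ⇒
`v ≡ ±1 (mod 8)` if `m ≡ 2 (mod 8)` and `v ≡ 1, 3 (mod 8)` if `m ≡ 6 (mod 8)`.  (`8 192` cases, kernel `decide`.) -/
theorem eps_table : ∀ (i : Fin 8) (j : Fin 4) (a b c d : Fin 4),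
    ((![0, 1, 4, 9] : Fin 4 → ZMod 16) c = 1 ∨ (![0, 1, 4, 9] : Fin 4 → ZMod 16) c = 9 ∨
      (![0, 1, 4, 9] : Fin 4 → ZMod 16) d = 1 ∨ (![0, 1, 4, 9] : Fin 4 → ZMod 16) d = 9) →
    (![1, 3, 5, 7, 9, 11, 13, 15] : Fin 8 → ZMod 16) i *
        ((![0, 1, 4, 9] : Fin 4 → ZMod 16) c - (![2, 6, 10, 14] : Fin 4 → ZMod 16) j * (![0, 1, 4, 9] : Fin 4 → ZMod 16) d)
      = (![0, 1, 4, 9] : Fin 4 → ZMod 16) a - (![2, 6, 10, 14] : Fin 4 → ZMod 16) j * (![0, 1, 4, 9] : Fin 4 → ZMod 16) b →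
    ((j = 0 ∨ j = 2) → ((![1, 3, 5, 7, 9, 11, 13, 15] : Fin 8 → ZMod 16) i = 1 ∨
      (![1, 3, 5, 7, 9, 11, 13, 15] : Fin 8 → ZMod 16) i = 7 ∨ (![1, 3, 5, 7, 9, 11, 13, 15] : Fin 8 → ZMod 16) i = 9 ∨
      (![1, 3, 5, 7, 9, 11, 13, 15] : Fin 8 → ZMod 16) i = 15)) ∧
    ((j = 1 ∨ j = 3) → ((![1, 3, 5, 7, 9, 11, 13, 15] : Fin 8 → ZMod 16) i = 1 ∨
      (![1, 3, 5, 7, 9, 11, 13, 15] : Fin 8 → ZMod 16) i = 3 ∨ (![1, 3, 5, 7, 9, 11, 13, 15] : Fin 8 → ZMod 16) i = 9 ∨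
      (![1, 3, 5, 7, 9, 11, 13, 15] : Fin 8 → ZMod 16) i = 11)) := by
  decide

/-! ## Glue: integers to residues -/

/-- Coprime integers are not both even. -/
theorem odd_or_odd_of_isCoprime {x y : ℤ} (h : IsCoprime x y) : Odd x ∨ Odd y := by
  by_contra hc
  rw [not_or, Int.not_odd_iff_even, Int.not_odd_iff_even, even_iff_two_dvd, even_iff_two_dvd] at hc
  have h2 : ¬ IsUnit (2 : ℤ) := by rw [Int.isUnit_iff]; omega
  exact h2 (h.isUnit_of_dvd' hc.1 hc.2)

/-- An odd integer is `2T + 1` modulo `k`. -/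
theorem cast_odd {v : ℤ} (hv : Odd v) (k : ℕ) : ∃ T : ZMod k, (v : ZMod k) = 2 * T + 1 := by
  obtain ⟨t, rfl⟩ := hv
  exact ⟨(t : ZMod k), by push_cast; ring⟩

/-- `(v : ZMod k) = r` gives `k ∣ v − r`. -/
theorem dvd_of_cast_eq {v r : ℤ} {k : ℕ} [NeZero k] (h : (v : ZMod k) = (r : ZMod k)) : (k : ℤ) ∣ v - r :=
  (ZMod.intCast_zmod_eq_zero_iff_dvd _ k).1 (by push_cast; rw [h]; ring)

/-- `k ∣ m − r` gives `(m : ZMod k) = r`. -/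
theorem cast_eq_of_dvd {m r : ℤ} {k : ℕ} [NeZero k] (h : (k : ℤ) ∣ m - r) : (m : ZMod k) = (r : ZMod k) := by
  have := (ZMod.intCast_zmod_eq_zero_iff_dvd _ k).2 h
  push_cast at this
  exact sub_eq_zero.1 this

/-- **`δ(v) = +1` in numbers**: for `m ≡ 3 (mod 4)`, `n = x² − m y²` with `x, y` coprime and `v·n = a² − m b²` with `v` odd,
`v ≡ 1 (mod 4)`. -/
theorem mod_four_of_delta {m n v x y a b : ℤ} (hm : m % 4 = 3) (hrep : x ^ 2 - m * y ^ 2 = n) (hxy : IsCoprime x y)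
    (hvn : v * n = a ^ 2 - m * b ^ 2) (hv : Odd v) : v % 4 = 1 := by
  obtain ⟨T, hT⟩ := cast_odd hv 8
  obtain ⟨i, hi⟩ := odd_mod_eight T
  obtain ⟨ia, ha⟩ := sq_mod_eight (a : ZMod 8)
  obtain ⟨ib, hb⟩ := sq_mod_eight (b : ZMod 8)
  obtain ⟨ix, hx⟩ := sq_mod_eight (x : ZMod 8)
  obtain ⟨iy, hy⟩ := sq_mod_eight (y : ZMod 8)
  obtain ⟨j, hj⟩ : ∃ j : Fin 2, (m : ZMod 8) = (![3, 7] : Fin 2 → ZMod 8) j := by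
    have hm8 : m % 8 = 3 ∨ m % 8 = 7 := by omega
    rcases hm8 with h | h
    · exact ⟨0, by rw [cast_eq_of_dvd (r := 3) (k := 8) (by omega)]; rfl⟩
    · exact ⟨1, by rw [cast_eq_of_dvd (r := 7) (k := 8) (by omega)]; rfl⟩
  have hodd : (![0, 1, 4] : Fin 3 → ZMod 8) ix = 1 ∨ (![0, 1, 4] : Fin 3 → ZMod 8) iy = 1 := by
    rcases odd_or_odd_of_isCoprime hxy with h | h
    · left; obtain ⟨S, hS⟩ := cast_odd h 8; rw [← hx, hS, odd_sq_mod_eight]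
    · right; obtain ⟨S, hS⟩ := cast_odd h 8; rw [← hy, hS, odd_sq_mod_eight]
  have heq : (![1, 3, 5, 7] : Fin 4 → ZMod 8) i *
        ((![0, 1, 4] : Fin 3 → ZMod 8) ix - (![3, 7] : Fin 2 → ZMod 8) j * (![0, 1, 4] : Fin 3 → ZMod 8) iy)
      = (![0, 1, 4] : Fin 3 → ZMod 8) ia - (![3, 7] : Fin 2 → ZMod 8) j * (![0, 1, 4] : Fin 3 → ZMod 8) ib := by
    rw [← hi, ← hT, ← hx, ← hy, ← ha, ← hb, ← hj]
    have e1 := congrArg (Int.cast : ℤ → ZMod 8) hvn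
    have e2 := congrArg (Int.cast : ℤ → ZMod 8) hrep
    push_cast at e1 e2
    rw [← e2] at e1
    exact e1
  have hconc := delta_table i j ia ib ix iy hodd heq
  rw [← hi, ← hT] at hconc
  rcases hconc with h | h
  · have := dvd_of_cast_eq (r := 1) (k := 8) (by exact_mod_cast h); omega
  · have := dvd_of_cast_eq (r := 5) (k := 8) (by exact_mod_cast h); omega

/-- **`ε(v) = +1` resp. `δε(v) = +1` in numbers**: for `m ≡ 2 (mod 4)`, `n = x² − m y²` with `x, y` coprime and
`v·n = a² − m b²` with `v` odd: `v ≡ ±1 (mod 8)` if `m ≡ 2 (mod 8)`, `v ≡ 1, 3 (mod 8)` if `m ≡ 6 (mod 8)`. -/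
theorem mod_eight_of_eps {m n v x y a b : ℤ} (hm : m % 4 = 2) (hrep : x ^ 2 - m * y ^ 2 = n) (hxy : IsCoprime x y)
    (hvn : v * n = a ^ 2 - m * b ^ 2) (hv : Odd v) :
    (m % 8 = 2 → v % 8 = 1 ∨ v % 8 = 7) ∧ (m % 8 = 6 → v % 8 = 1 ∨ v % 8 = 3) := by
  obtain ⟨T, hT⟩ := cast_odd hv 16
  obtain ⟨i, hi⟩ := odd_mod_sixteen T
  obtain ⟨ia, ha⟩ := sq_mod_sixteen (a : ZMod 16)
  obtain ⟨ib, hb⟩ := sq_mod_sixteen (b : ZMod 16)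
  obtain ⟨ix, hx⟩ := sq_mod_sixteen (x : ZMod 16)
  obtain ⟨iy, hy⟩ := sq_mod_sixteen (y : ZMod 16)
  obtain ⟨j, hj, hj2, hj6⟩ : ∃ j : Fin 4, (m : ZMod 16) = (![2, 6, 10, 14] : Fin 4 → ZMod 16) j ∧
      (m % 8 = 2 → j = 0 ∨ j = 2) ∧ (m % 8 = 6 → j = 1 ∨ j = 3) := by
    have hm16 : m % 16 = 2 ∨ m % 16 = 6 ∨ m % 16 = 10 ∨ m % 16 = 14 := by omega
    rcases hm16 with h | h | h | h
    · exact ⟨0, by rw [cast_eq_of_dvd (r := 2) (k := 16) (by omega)]; rfl, fun _ => Or.inl rfl, fun h' => by omega⟩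
    · exact ⟨1, by rw [cast_eq_of_dvd (r := 6) (k := 16) (by omega)]; rfl, fun h' => by omega, fun _ => Or.inl rfl⟩
    · exact ⟨2, by rw [cast_eq_of_dvd (r := 10) (k := 16) (by omega)]; rfl, fun _ => Or.inr rfl, fun h' => by omega⟩
    · exact ⟨3, by rw [cast_eq_of_dvd (r := 14) (k := 16) (by omega)]; rfl, fun h' => by omega, fun _ => Or.inr rfl⟩
  have hodd : (![0, 1, 4, 9] : Fin 4 → ZMod 16) ix = 1 ∨ (![0, 1, 4, 9] : Fin 4 → ZMod 16) ix = 9 ∨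
      (![0, 1, 4, 9] : Fin 4 → ZMod 16) iy = 1 ∨ (![0, 1, 4, 9] : Fin 4 → ZMod 16) iy = 9 := by
    rcases odd_or_odd_of_isCoprime hxy with h | h
    · obtain ⟨S, hS⟩ := cast_odd h 16
      rw [← hx, hS]
      rcases odd_sq_mod_sixteen S with h1 | h9
      · exact Or.inl h1
      · exact Or.inr (Or.inl h9)
    · obtain ⟨S, hS⟩ := cast_odd h 16
      rw [← hy, hS]
      rcases odd_sq_mod_sixteen S with h1 | h9
      · exact Or.inr (Or.inr (Or.inl h1))
      · exact Or.inr (Or.inr (Or.inr h9))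
  have heq : (![1, 3, 5, 7, 9, 11, 13, 15] : Fin 8 → ZMod 16) i *
        ((![0, 1, 4, 9] : Fin 4 → ZMod 16) ix - (![2, 6, 10, 14] : Fin 4 → ZMod 16) j * (![0, 1, 4, 9] : Fin 4 → ZMod 16) iy)
      = (![0, 1, 4, 9] : Fin 4 → ZMod 16) ia - (![2, 6, 10, 14] : Fin 4 → ZMod 16) j * (![0, 1, 4, 9] : Fin 4 → ZMod 16) ib := by
    rw [← hi, ← hT, ← hx, ← hy, ← ha, ← hb, ← hj]
    have e1 := congrArg (Int.cast : ℤ → ZMod 16) hvn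
    have e2 := congrArg (Int.cast : ℤ → ZMod 16) hrep
    push_cast at e1 e2
    rw [← e2] at e1
    exact e1
  obtain ⟨h2, h6⟩ := eps_table i j ia ib ix iy hodd heq
  rw [← hi, ← hT] at h2 h6
  constructor
  · intro hm2
    rcases h2 (hj2 hm2) with h | h | h | h
    · have := dvd_of_cast_eq (r := 1) (k := 16) (by exact_mod_cast h); omega
    · have := dvd_of_cast_eq (r := 7) (k := 16) (by exact_mod_cast h); omega
    · have := dvd_of_cast_eq (r := 9) (k := 16) (by exact_mod_cast h); omega
    · have := dvd_of_cast_eq (r := 15) (k := 16) (by exact_mod_cast h); omega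
  · intro hm6
    rcases h6 (hj6 hm6) with h | h | h | h
    · have := dvd_of_cast_eq (r := 1) (k := 16) (by exact_mod_cast h); omega
    · have := dvd_of_cast_eq (r := 3) (k := 16) (by exact_mod_cast h); omega
    · have := dvd_of_cast_eq (r := 9) (k := 16) (by exact_mod_cast h); omega
    · have := dvd_of_cast_eq (r := 11) (k := 16) (by exact_mod_cast h); omega

/-! ## Every assigned character is `+1` at a coprime value of the form -/

/-- **Gauss's complete character of the form `(n, 2A, k)` is trivial**: `m < 0` squarefree, `n = x² − m y²` (`x, y` coprime),
`A² − n k = m`, `v` a value of the form prime to `4m` with `v·n = a² − m b²`; then every assigned character of `4m` is `+1` at `v`: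
`χ_q(v) = 1` (#B22 `legendreSym_value_eq_one`), `δ(v) = 1` (`m ≡ 3 (4)`), `ε(v) = 1` (`m ≡ 2 (8)`), `δε(v) = 1` (`m ≡ 6 (8)`). -/
theorem unitHom_eq_one {m : ℤ} (hm : m < 0) (hsq : Squarefree m) {n v x y a b : ℤ}
    (hrep : x ^ 2 - m * y ^ 2 = n) (hxy : IsCoprime x y) (hv : IsCoprime v (4 * m)) (hvn : v * n = a ^ 2 - m * b ^ 2)
    (c : assignedChars (4 * m)) : (c.1).unitHom (4 * m).natAbs (unitOfIsCoprime hv) = 1 := by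
  have hcoe : ((unitOfIsCoprime hv : (ZMod (4 * m).natAbs)ˣ) : ZMod (4 * m).natAbs) = (v : ZMod (4 * m).natAbs) := rfl
  have hD0 : 4 * m ≠ 0 := by omega
  have hD4 : (4 * m) % 4 = 0 ∨ (4 * m) % 4 = 1 := Or.inl (by omega)
  have hN : ((4 * m).natAbs : ℤ) = -(4 * m) := Int.ofNat_natAbs_of_nonpos (by omega)
  have h4m : ¬ (4 : ℤ) ∣ m := by
    rintro ⟨t, ht⟩
    have h2 : ¬ IsUnit (2 : ℤ) := by rw [Int.isUnit_iff]; omega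
    exact h2 (hsq 2 ⟨t, by rw [ht]; ring⟩)
  have hvodd : Odd v := by
    rw [← Int.not_even_iff_odd, even_iff_two_dvd]
    intro h2v
    have h2 : ¬ IsUnit (2 : ℤ) := by rw [Int.isUnit_iff]; omega
    exact h2 (hv.isUnit_of_dvd' h2v ⟨2 * m, by ring⟩)
  obtain ⟨c, hc⟩ := c
  apply Units.val_eq_one.1
  cases c with
  | legendre p =>
    obtain ⟨hp, hp2, hpd⟩ := (legendre_mem_assignedChars_iff hD0).1 hc
    haveI : Fact p.Prime := ⟨hp⟩
    have hpZ : Prime (p : ℤ) := Nat.prime_iff_prime_int.1 hp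
    have hpm : (p : ℤ) ∣ m := by
      have h4 : (p : ℤ) ∣ 4 * m := Int.natCast_dvd.2 hpd
      rcases hpZ.dvd_or_dvd h4 with h | h
      · exfalso
        have h22 : (p : ℤ) ∣ 2 * 2 := by norm_num; exact h
        have h2 : (p : ℤ) ∣ 2 := (hpZ.dvd_or_dvd h22).elim id id
        have h2' : p ∣ 2 := by exact_mod_cast h2
        exact hp2 ((Nat.prime_dvd_prime_iff_eq hp Nat.prime_two).1 h2')
      · exact h
    have hpv : ¬ (p : ℤ) ∣ v := fun h => hpZ.not_unit (hv.isUnit_of_dvd' h (dvd_mul_of_dvd_right hpm 4))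
    show ((unitHom (legendre p) (4 * m).natAbs (unitOfIsCoprime hv) : ℤˣ) : ℤ) = 1
    rw [coe_unitHom_legendre hpd hcoe.symm]
    exact legendreSym_value_eq_one hsq hpm hrep hxy hvn hpv
  | delta =>
    obtain ⟨-, h⟩ := (delta_mem_assignedChars_iff hD4).1 hc
    have hm3 : m % 4 = 3 := by omega
    have h4N : 4 ∣ (4 * m).natAbs := by omega
    have hv4 := mod_four_of_delta hm3 hrep hxy hvn hvodd
    show ((unitHom delta (4 * m).natAbs (unitOfIsCoprime hv) : ℤˣ) : ℤ) = 1
    rw [coe_unitHom_delta h4N hcoe.symm, ZMod.χ₄_int_eq_if_mod_four, if_neg (by omega), if_pos hv4]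
  | epsilon =>
    obtain ⟨-, h⟩ := (epsilon_mem_assignedChars_iff hD4).1 hc
    have hm2 : m % 8 = 2 := by omega
    have h8N : 8 ∣ (4 * m).natAbs := by omega
    have hv8 := (mod_eight_of_eps (by omega) hrep hxy hvn hvodd).1 hm2
    show ((unitHom epsilon (4 * m).natAbs (unitOfIsCoprime hv) : ℤˣ) : ℤ) = 1
    rw [coe_unitHom_epsilon h8N hcoe.symm, ZMod.χ₈_int_eq_if_mod_eight, if_neg (by omega), if_pos hv8]
  | deltaEpsilon =>
    obtain ⟨-, h⟩ := (deltaEpsilon_mem_assignedChars_iff hD4).1 hc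
    have hm6 : m % 8 = 6 := by omega
    have h8N : 8 ∣ (4 * m).natAbs := by omega
    have hv8 := (mod_eight_of_eps (by omega) hrep hxy hvn hvodd).2 hm6
    show ((unitHom deltaEpsilon (4 * m).natAbs (unitOfIsCoprime hv) : ℤˣ) : ℤ) = 1
    rw [coe_unitHom_deltaEpsilon h8N hcoe.symm, ZMod.χ₈'_int_eq_if_mod_eight, if_neg (by omega), if_pos hv8]

/-! ## The general capture -/

/-- **THE GENERAL CAPTURE, one class per genus stated on forms, ANY squarefree `m < 0`.**  `n = x² − m y² > 0` with `x, y`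
coprime; `A² − n k = m`; `(n, 2A, k)` primitive.  Then some primitive `z ∈ ℤ√m` with `N z = n` divides `A − √m`.  Route: a value
`v` of the form prime to `4m` (Cox Lemma 2.25, tree); every assigned character is `+1` at `v` (`unitHom_eq_one`); principal genus
(tree `mem_principalValues_iff_completeChar_eq_one`); one class per genus ⇒ properly equivalent to the principal form ⇒ trivial
ideal class (Cox Thm 7.7, tree) ⇒ `𝔞_n(A)` principal ⇒ 315's §11 PROPOSITION. -/
theorem capture_all_of_forall_genus {m : ℤ} (hm : m < 0) (hsq : Squarefree m)
    (H : ∀ f g : BinQF, f.IsPosPrim (4 * m) → g.IsPosPrim (4 * m) → f.genus (4 * m) = g.genus (4 * m) → f.ProperEquiv g)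
    {n k A x y : ℤ} (hn : 0 < n) (hk : A ^ 2 - n * k = m) (hrep : x ^ 2 - m * y ^ 2 = n) (hxy : IsCoprime x y)
    (hprim : ∀ d : ℤ, d ∣ n → d ∣ 2 * A → d ∣ k → IsUnit d) :
    ∃ z : ℤ√m, z.norm = n ∧ z ∣ (⟨A, -1⟩ : ℤ√m) ∧ IsCoprime z.re z.im := by
  haveI : IsDomain (ℤ√m) := Zsqrtd.isDomain_of_neg hm
  have hD : 4 * m < 0 := by omega
  have hD4 : (4 * m) % 4 = 0 ∨ (4 * m) % 4 = 1 := Or.inl (by omega)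
  set f : BinQF := ⟨n, 2 * A, k⟩ with hfdef
  have hf : f.IsPosPrim (4 * m) := lineForm_isPosPrim_of_primitive hn hk hprim
  obtain ⟨x₀, y₀, -, hv⟩ := BinQF.exists_eval_isCoprime hf.primitive (M := 4 * m) (by omega)
  set v : ℤ := f.eval x₀ y₀ with hvdef
  have hvn : v * n = (n * x₀ + A * y₀) ^ 2 - m * y₀ ^ 2 := eval_mul_n hk
  let u : (ZMod (4 * m).natAbs)ˣ := unitOfIsCoprime hv
  have hcoe : (u : ZMod (4 * m).natAbs) = (v : ZMod (4 * m).natAbs) := rfl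
  have hu : u ∈ f.valueSet (4 * m) := ⟨x₀, y₀, hcoe.symm⟩
  have hchar : completeChar (4 * m) u = 1 := by
    funext c
    rw [completeChar_apply]
    exact unitHom_eq_one hm hsq hrep hxy hv hvn c
  let Δ : NegDiscr := ⟨4 * m, hD⟩
  have hmem : u ∈ principalValues (4 * m) := (mem_principalValues_iff_completeChar_eq_one Δ hD4).2 hchar
  have hgen : f.genus (4 * m) = (one (4 * m)).genus (4 * m) := by
    rw [BinQF.genus_eq_mk hD hf hu, genus_one hD hD4]
    exact (QuotientGroup.eq_one_iff u).2 hmem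
  have hpe : f.ProperEquiv (one (4 * m)) := H _ _ hf (isPosPrim_one hD hD4).1 hgen
  have hcl : BinQF.toClass m f = 1 := by
    rw [BinQF.toClass_eq_of_properEquiv hm hf hpe, one_four_mul_eq_principalForm, BinQF.toClass_principalForm]
  have hunit := BinQF.isUnit_fracIdeal_of_isPosPrim hf
  rw [BinQF.toClass_of_isUnit hunit] at hcl
  have hP := ClassGroup.mk_eq_one_iff.1 hcl
  rw [hunit.unit_spec] at hP
  obtain ⟨z, hz⟩ := exists_span_singleton_of_coe_isPrincipal (K := FractionRing (ℤ√m)) (BinQF.ideal m f) hP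
  rw [hfdef, ideal_lineForm] at hz
  obtain ⟨hdvd, hnorm⟩ := dvd_and_norm_of_span_eq hn.ne' hk hz
  have h0 := Zsqrtd.norm_nonneg hm.le z
  refine ⟨z, ?_, hdvd, ?_⟩
  · rcases hnorm with h | h
    · exact h
    · omega
  · obtain ⟨w, hw⟩ := hdvd
    exact isCoprime_of_dvd hw.symm

/-- **THE GENERAL CAPTURE under `h(4m) = 2^{μ−1}`** (one class per genus, Cox Thm 3.22 (v)), ANY squarefree `m < 0`. -/
theorem capture_all {m : ℤ} (hm : m < 0) (hsq : Squarefree m)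
    (hh : BinaryQuadraticForm.classNumber (4 * m) = 2 ^ (assignedCharCount (4 * m) - 1))
    {n k A x y : ℤ} (hn : 0 < n) (hk : A ^ 2 - n * k = m) (hrep : x ^ 2 - m * y ^ 2 = n) (hxy : IsCoprime x y)
    (hprim : ∀ d : ℤ, d ∣ n → d ∣ 2 * A → d ∣ k → IsUnit d) :
    ∃ z : ℤ√m, z.norm = n ∧ z ∣ (⟨A, -1⟩ : ℤ√m) ∧ IsCoprime z.re z.im := by
  let Δ : NegDiscr := ⟨4 * m, by omega⟩
  have hD4 : Δ.D % 4 = 0 ∨ Δ.D % 4 = 1 := Or.inl (show (4 * m) % 4 = 0 by omega)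
  have hsq1 := (forall_sq_eq_one_iff_classNumber_eq Δ hD4).2 hh
  exact capture_all_of_forall_genus hm hsq
    ((forall_genus_eq_imp_properEquiv_iff_forall_sq_eq_one Δ hD4).2 hsq1) hn hk hrep hxy hprim

/-- **THE GENERAL CAPTURE with the 2-ADIC RULE as printed**: `n` or `k = (A² − m)∕n` odd replaces primitivity (`m` squarefree). -/
theorem capture_all_of_parity {m : ℤ} (hm : m < 0) (hsq : Squarefree m)
    (hh : BinaryQuadraticForm.classNumber (4 * m) = 2 ^ (assignedCharCount (4 * m) - 1))
    {n k A x y : ℤ} (hn : 0 < n) (hk : A ^ 2 - n * k = m) (hrep : x ^ 2 - m * y ^ 2 = n) (hxy : IsCoprime x y)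
    (h2 : Odd n ∨ Odd k) : ∃ z : ℤ√m, z.norm = n ∧ z ∣ (⟨A, -1⟩ : ℤ√m) ∧ IsCoprime z.re z.im :=
  capture_all hm hsq hh hn hk hrep hxy (lineForm_primitive_of_squarefree hsq hk h2)

/-! ## THEOREM A «⇐» assembled for `m ≡ 2, 3 (mod 4)` -/

/-- For `m ≡ 2, 3 (mod 4)`, `A² − m` is never divisible by `4` — so on an even weight the cofactor is automatically odd
(PROPOSITION 2: `e = 1`). -/
theorem not_four_dvd_sq_sub {m : ℤ} (hm : m % 4 = 2 ∨ m % 4 = 3) (A : ℤ) : ¬ (4 : ℤ) ∣ A ^ 2 - m := by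
  rintro ⟨t, ht⟩
  rcases Literature.NumberTheory.CubicFields.Int.sq_emod_four A with h | h <;> omega

/-- **THEOREM A «⇐» for `m ≡ 2, 3 (mod 4)`** (LINE-LAW-THEOREMS-B §2; `m < 0` squarefree, `h(4m) = 2^{μ−1}`): if every listed
quotient `n` is a primitive norm `x² − m y² > 0` (weights prime to `4m`, ramified and EVEN weights alike, no 2-adic hypothesis —
the rule `e = 1` holds by itself), then ONE integer `A` serves all: each `n` is `N z` for a primitive `z ∣ A − √m`.  With THEOREM CF⁶
by value: the line is reached at `T`.  (324's common root; `capture_all_of_parity` per weight, the cofactor of an even weight being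
odd by `not_four_dvd_sq_sub`.) -/
theorem lineLaw_sufficiency_two_three {m : ℤ} (hm : m < 0) (hm4 : m % 4 = 2 ∨ m % 4 = 3) (hsq : Squarefree m)
    (hh : BinaryQuadraticForm.classNumber (4 * m) = 2 ^ (assignedCharCount (4 * m) - 1))
    (ns : List ℕ) (hrep : ∀ n ∈ ns, 0 < n ∧ ∃ x y : ℤ, x ^ 2 - m * y ^ 2 = n ∧ IsCoprime x y) :
    ∃ A : ℤ, ∀ n ∈ ns, ∃ z : ℤ√m, z.norm = n ∧ z ∣ (⟨A, -1⟩ : ℤ√m) ∧ IsCoprime z.re z.im := by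
  have hroot : ∀ n ∈ ns, 0 < n ∧ ∃ A : ℤ, (n : ℤ) ∣ A ^ 2 - m := by
    intro n hn
    obtain ⟨hpos, x, y, hxyn, hxy⟩ := hrep n hn
    obtain ⟨A, hA⟩ := exists_root_of_primitive_rep m hxy
    exact ⟨hpos, A, by rwa [hxyn] at hA⟩
  obtain ⟨A, hA⟩ := exists_common_root ns hroot
  refine ⟨A, fun n hn => ?_⟩
  obtain ⟨hpos, x, y, hxyn, hxy⟩ := hrep n hn
  obtain ⟨k, hk⟩ := hA n hn
  have hk' : A ^ 2 - n * k = m := by linear_combination hk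
  refine capture_all_of_parity hm hsq hh (by exact_mod_cast hpos) hk' hxyn hxy ?_
  by_cases hn2 : 2 ∣ n
  · right
    rw [← Int.not_even_iff_odd, even_iff_two_dvd]
    rintro ⟨k', rfl⟩
    obtain ⟨n', rfl⟩ := hn2
    exact not_four_dvd_sq_sub hm4 A ⟨n' * k', by rw [hk]; push_cast; ring⟩
  · left
    exact (Int.odd_coe_nat n).2 (Nat.odd_iff.2 (by omega))

/-- **Instance in numbers (`m = −5 ≡ 3 (mod 4)`, `h(−20) = 2 = 2^{μ−1}`, Euler's `5`)**: the EVEN quotient `6 = N(1 − √−5)` and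
the RAMIFIED quotient `5 = N(√−5)` share the root `A = 25`: `25² + 5 = 630 = 6·105 = 5·126` (the even weight's cofactor `105` is odd,
as `not_four_dvd_sq_sub` predicts), and `(1 − √−5)(5 + 4√−5) = 25 − √−5 = √−5·(−1 − 5√−5)`. -/
example : (25 : ℤ) ^ 2 - (-5) = 6 * 105 ∧ (25 : ℤ) ^ 2 - (-5) = 5 * 126 ∧
    (⟨1, -1⟩ : ℤ√(-5)) * ⟨5, 4⟩ = ⟨25, -1⟩ ∧ (⟨0, 1⟩ : ℤ√(-5)) * ⟨-1, -5⟩ = ⟨25, -1⟩ := by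
  refine ⟨by norm_num, by norm_num, by ext <;> simp, by ext <;> simp⟩
end Summit.Ventures.HSemireg.LineLawGeneralCaptureAll
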